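import Literature.NumberTheory.Sieve.HeathBrownCubicLemma111
import HarnessLib

/-!
# Lattice-point geometry in `ℤ³` for Heath-Brown's Lemma 3.10 (§§11–12)

Pure-proof toolkit (no named facts) for the decomposition of **Heath-Brown's Type II estimate,
Lemma 3.10** (`HeathBrown2001_lemma_3_10` of `HeathBrownCubicTypeII`), D. R. Heath-Brown, *Primes
represented by `x³ + 2y³`*, Acta Math. 186 (2001), §§11–12. The printed argument uses, at four
places, elementary counts of integer vectors: "`β̂₂` is confined to a circular cylinder of radius
`O(DXV^{−2/3})` and length `O(V^{1/3})` … contains `O(V^{1/3}(DXV^{−2/3})²)` points" (p. 71); Lemma 4.8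
("the set of `x ∈ ℤ³` for which `w·x = 0` forms a 2-dimensional lattice of determinant `|w|` … `z₁ ∧ z₂ = ±w`",
p. 25) with the counts of p. 77 ("the number of values taken by `β₂` is `≪ (V^{2/3}/(|z₁||z₂|))(1 + V^{1/3}/|z₂|)`");
and Lemma 4.9 (points near a non-singular hypersurface, p. 26: "either `δ ≪ S₀` or `|δ| ≫ R` … it follows
that `#ℬ₁(u) ≪ 1`"). We PROVE sup-norm versions sufficient for §§11–12:

* `supZ` (sup norm on `ℤ³`), `dot3`; `cross3` algebra: `cross3_sub_right/left`, `cross3_self`,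
  `abs_cross3_le` (`|a ∧ b|_∞ ≤ 2|a|_∞|b|_∞`), `IsPrimitiveVec.ne_zero`;
* **`eq_smul_of_cross3_eq_zero`** — an integer vector parallel to a primitive `a` is an integer
  multiple of `a` (BAC–CAB with a Bézout vector), and `cross3_cross3_eq_zero` (`n ∧ (x ∧ b) = 0` for
  `x, b ⊥ n`): together, Lemma 4.8's "`z₁ ∧ z₂ = ±w`" in the form `x ∧ b = μ n`, `μ ∈ ℤ`;
* `card_int_le_of_forall_mem_Icc` (`#T ≤ L + 1` for integers in a real interval of length `L`);
* **`card_filter_abs_cross3_le`** — the cylinder count of p. 71: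
  `#{m : |γ ∧ m|_∞ ≤ ρ, |m − c|_∞ ≤ R} ≤ (2R + 1)(2ρ/|γ|_∞ + 1)²`;
* **`card_filter_abs_dot_sub_le`** — integer points of a box in a slab:
  `#{n : |n − c|_∞ ≤ R, |a·n − h| ≤ w} ≤ (2R + 1)²(2w/|a|_∞ + 1)` (the linear case of Lemma 4.9);
* **`card_filter_dot_eq_zero_le`** — points of the plane lattice `n^⊥` in a box, fibred along a
  primitive `b ⊥ n`: `≤ (8U|b|_∞/|n|_∞ + 1)(2U/|b|_∞ + 1)` (the counts of p. 77 / Lemma 4.8);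
* **`card_le_of_gap`** — the combinatorial heart of Lemma 4.9: a set of integers in an interval of
  length `ℓ` whose pairwise distances are `≤ A` or `≥ B` has `≤ (ℓ/B + 1)(A + 1)` elements — and
  **`card_le_of_cubic_near_level`**, its application to a one-variable cubic `αt³ + βt`
  ("`F(v₁ + δ, u) = F(v₁, u) + δ ∂F/∂x₁ + O(Rδ²)` … either `δ ≪ S₀` or `|δ| ≫ R`", p. 26).

## References

* D. R. Heath-Brown, *Primes represented by `x³ + 2y³`*, Acta Math. 186 (2001), 1–84: Lemma 4.8
  p. 25, Lemma 4.9 p. 26, §11 p. 71, §12 p. 77. [cite: HeathBrownActa2001, Lemma 4.9]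

## Mathlib / tree search

Mathlib: `Finset.card_le_mul_card_image`, `Finset.card_le_card_of_injOn`, `Int.card_Icc`,
`Int.floor`/`Int.ceil` API; no lattice-point counting in cylinders/slabs. Tree: `HeathBrownCubicLemma111`
(`cross3`, `IsPrimitiveVec`, `DvdVec`, `exists_dot_eq_one`).
-/

noncomputable section

open Finset

namespace Literature.NumberTheory.Sieve.CubicSieve

/-! ### Sup norm, dot and cross products on `ℤ³` -/

/-- The sup norm `|v|_∞ = max(|v₁|, |v₂|, |v₃|)` of an integer vector. [folklore] -/
def supZ (v : ℤ × ℤ × ℤ) : ℤ := max |v.1| (max |v.2.1| |v.2.2|)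

/-- The dot product on `ℤ³`. [folklore] -/
def dot3 (a b : ℤ × ℤ × ℤ) : ℤ := a.1 * b.1 + a.2.1 * b.2.1 + a.2.2 * b.2.2

/-- `|v₁| ≤ |v|_∞`. [folklore] -/
theorem abs_fst_le_supZ (v : ℤ × ℤ × ℤ) : |v.1| ≤ supZ v := le_max_left _ _

/-- `|v₂| ≤ |v|_∞`. [folklore] -/
theorem abs_snd_le_supZ (v : ℤ × ℤ × ℤ) : |v.2.1| ≤ supZ v := (le_max_left _ _).trans (le_max_right _ _)

/-- `|v₃| ≤ |v|_∞`. [folklore] -/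
theorem abs_thd_le_supZ (v : ℤ × ℤ × ℤ) : |v.2.2| ≤ supZ v := (le_max_right _ _).trans (le_max_right _ _)

/-- `|v|_∞ ≥ 0`. [folklore] -/
theorem supZ_nonneg (v : ℤ × ℤ × ℤ) : 0 ≤ supZ v := (abs_nonneg _).trans (abs_fst_le_supZ v)

/-- `|v|_∞ = 0 ↔ v = 0`. [folklore] -/
theorem supZ_eq_zero_iff (v : ℤ × ℤ × ℤ) : supZ v = 0 ↔ v = 0 := by
  constructor
  · intro h
    have h1 := abs_fst_le_supZ v; have h2 := abs_snd_le_supZ v; have h3 := abs_thd_le_supZ v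
    rw [h] at h1 h2 h3
    ext
    · exact abs_nonpos_iff.mp h1
    · exact abs_nonpos_iff.mp h2
    · exact abs_nonpos_iff.mp h3
  · rintro rfl; simp [supZ]

/-- `|v|_∞ ≥ 1` for `v ≠ 0`. [folklore] -/
theorem one_le_supZ {v : ℤ × ℤ × ℤ} (hv : v ≠ 0) : 1 ≤ supZ v := by
  have h0 := supZ_nonneg v
  have hne : supZ v ≠ 0 := fun h => hv ((supZ_eq_zero_iff v).mp h)
  omega

/-- Some coordinate attains the sup norm. [folklore] -/
theorem exists_abs_eq_supZ (v : ℤ × ℤ × ℤ) :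
    |v.1| = supZ v ∨ |v.2.1| = supZ v ∨ |v.2.2| = supZ v := by
  simp only [supZ]
  rcases le_total |v.1| (max |v.2.1| |v.2.2|) with h | h
  · rw [max_eq_right h]
    rcases le_total |v.2.1| |v.2.2| with h' | h'
    · rw [max_eq_right h']; exact Or.inr (Or.inr rfl)
    · rw [max_eq_left h']; exact Or.inr (Or.inl rfl)
  · rw [max_eq_left h]; exact Or.inl rfl

/-- `|v − w|_∞`-type bound: each coordinate of `v` is within `supZ` of `0`, real version. [folklore] -/
theorem abs_cast_le_supZ (v : ℤ × ℤ × ℤ) :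
    |(v.1 : ℝ)| ≤ (supZ v : ℝ) ∧ |(v.2.1 : ℝ)| ≤ (supZ v : ℝ) ∧ |(v.2.2 : ℝ)| ≤ (supZ v : ℝ) := by
  refine ⟨?_, ?_, ?_⟩
  · rw [← Int.cast_abs]; exact_mod_cast abs_fst_le_supZ v
  · rw [← Int.cast_abs]; exact_mod_cast abs_snd_le_supZ v
  · rw [← Int.cast_abs]; exact_mod_cast abs_thd_le_supZ v

/-- `supZ (−v) = supZ v`. [folklore] -/
theorem supZ_neg (v : ℤ × ℤ × ℤ) : supZ (-v) = supZ v := by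
  simp [supZ, abs_neg]

/-- `supZ (μ • v) = |μ| supZ v`. [folklore] -/
theorem supZ_smul (μ : ℤ) (v : ℤ × ℤ × ℤ) : supZ (μ • v) = |μ| * supZ v := by
  simp only [supZ, Prod.smul_fst, Prod.smul_snd, smul_eq_mul, abs_mul]
  rw [mul_max_of_nonneg _ _ (abs_nonneg μ), mul_max_of_nonneg _ _ (abs_nonneg μ)]

/-- The cross product is antisymmetric. [folklore] -/
theorem cross3_swap (a b : ℤ × ℤ × ℤ) : cross3 a b = -cross3 b a := by
  ext <;> simp [cross3] <;> ring

/-- `a ∧ a = 0`. [folklore] -/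
theorem cross3_self (a : ℤ × ℤ × ℤ) : cross3 a a = 0 := by
  ext <;> simp [cross3] <;> ring

/-- The cross product is additive in the second argument (difference form). [folklore] -/
theorem cross3_sub_right (a x y : ℤ × ℤ × ℤ) : cross3 a (x - y) = cross3 a x - cross3 a y := by
  ext <;> simp [cross3] <;> ring

/-- The cross product is additive in the first argument (difference form). [folklore] -/
theorem cross3_sub_left (x y b : ℤ × ℤ × ℤ) : cross3 (x - y) b = cross3 x b - cross3 y b := by
  ext <;> simp [cross3] <;> ring

/-- `cross3 (μ • a) b = μ • cross3 a b`. [folklore] -/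
theorem cross3_smul_left (μ : ℤ) (a b : ℤ × ℤ × ℤ) : cross3 (μ • a) b = μ • cross3 a b := by
  ext <;> simp [cross3] <;> ring

/-- **`|a ∧ b|_∞ ≤ 2 |a|_∞ |b|_∞`.** [folklore] -/
theorem supZ_cross3_le (a b : ℤ × ℤ × ℤ) : supZ (cross3 a b) ≤ 2 * supZ a * supZ b := by
  have ha1 := abs_fst_le_supZ a; have ha2 := abs_snd_le_supZ a; have ha3 := abs_thd_le_supZ a
  have hb1 := abs_fst_le_supZ b; have hb2 := abs_snd_le_supZ b; have hb3 := abs_thd_le_supZ b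
  have hA := supZ_nonneg a; have hB := supZ_nonneg b
  have key : ∀ p q r s : ℤ, |p| ≤ supZ a → |q| ≤ supZ b → |r| ≤ supZ a → |s| ≤ supZ b →
      |p * q - r * s| ≤ 2 * supZ a * supZ b := by
    intro p q r s hp hq hr hs
    calc |p * q - r * s| ≤ |p * q| + |r * s| := abs_sub _ _
      _ = |p| * |q| + |r| * |s| := by rw [abs_mul, abs_mul]
      _ ≤ supZ a * supZ b + supZ a * supZ b :=
          add_le_add (mul_le_mul hp hq (abs_nonneg _) hA) (mul_le_mul hr hs (abs_nonneg _) hA)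
      _ = 2 * supZ a * supZ b := by ring
  simp only [supZ, cross3, max_le_iff] at *
  exact ⟨key _ _ _ _ ha2 hb3 ha3 hb2, key _ _ _ _ ha3 hb1 ha1 hb3, key _ _ _ _ ha1 hb2 ha2 hb1⟩

/-- A primitive vector is nonzero. [folklore] -/
theorem IsPrimitiveVec.ne_zero {b : ℤ × ℤ × ℤ} (hb : IsPrimitiveVec b) : b ≠ 0 := by
  rintro rfl
  have h := hb 2 (dvd_zero _) (dvd_zero _) (dvd_zero _)
  rw [Int.isUnit_iff] at h
  omega

/-- **An integer vector parallel to a primitive vector is an integer multiple of it**: if `c · a = 1`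
and `a ∧ w = 0` then `w = (c · w) a` (from `(a ∧ w) ∧ c = (a·c) w − (w·c) a`). This is the content of
"`ẑ₁ ∧ ẑ₂ = ±w`"/"`α̂` primitive ⇒ `α̂ = ±D⁻¹(β̂₁ ∧ β̂₂)`" ((11.4), Lemma 4.8). [cite: HeathBrownActa2001, §11 (11.4)] -/
theorem eq_smul_of_cross3_eq_zero {a c w : ℤ × ℤ × ℤ} (hc : dot3 c a = 1) (h : cross3 a w = 0) :
    w = dot3 c w • a := by
  simp only [dot3] at hc ⊢
  have h1 : a.2.1 * w.2.2 - a.2.2 * w.2.1 = 0 := by have := congrArg Prod.fst h; simpa [cross3] using this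
  have h2 : a.2.2 * w.1 - a.1 * w.2.2 = 0 := by
    have := congrArg (fun p => p.2.1) h; simpa [cross3] using this
  have h3 : a.1 * w.2.1 - a.2.1 * w.1 = 0 := by
    have := congrArg (fun p => p.2.2) h; simpa [cross3] using this
  ext
  · simp only [Prod.smul_fst, smul_eq_mul]
    linear_combination (-w.1) * hc - c.2.1 * h3 + c.2.2 * h2
  · simp only [Prod.smul_snd, Prod.smul_fst, smul_eq_mul]
    linear_combination (-w.2.1) * hc + c.1 * h3 - c.2.2 * h1
  · simp only [Prod.smul_snd, smul_eq_mul]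
    linear_combination (-w.2.2) * hc - c.1 * h2 + c.2.1 * h1

/-- A version with an existential: for `a` primitive, `a ∧ w = 0 ⇒ w ∈ ℤ a`. [folklore] -/
theorem exists_eq_smul_of_cross3_eq_zero {a w : ℤ × ℤ × ℤ} (ha : IsPrimitiveVec a)
    (h : cross3 a w = 0) : ∃ μ : ℤ, w = μ • a := by
  obtain ⟨c, hc⟩ := exists_dot_eq_one ha
  exact ⟨dot3 c w, eq_smul_of_cross3_eq_zero (by simpa [dot3] using hc) h⟩

/-- `n ∧ (x ∧ b) = 0` when `x ⊥ n` and `b ⊥ n` (BAC–CAB: `= (n·b) x − (n·x) b`). [folklore] -/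
theorem cross3_cross3_eq_zero {n x b : ℤ × ℤ × ℤ} (hx : dot3 n x = 0) (hb : dot3 n b = 0) :
    cross3 n (cross3 x b) = 0 := by
  simp only [dot3] at hx hb
  ext
  · simp only [cross3, Prod.fst_zero]
    linear_combination x.1 * hb - b.1 * hx
  · simp only [cross3, Prod.snd_zero, Prod.fst_zero]
    linear_combination x.2.1 * hb - b.2.1 * hx
  · simp only [cross3, Prod.snd_zero]
    linear_combination x.2.2 * hb - b.2.2 * hx

/-- **`x ∧ b = μ n` with `μ ∈ ℤ`** for `x, b` in the plane `n^⊥` of a primitive `n` (Lemma 4.8: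
"`z₁ ∧ z₂ = ±w`" generalised to any two vectors of the dual lattice). [cite: HeathBrownActa2001, Lemma 4.8] -/
theorem cross3_eq_smul_of_dot_eq_zero {n c x b : ℤ × ℤ × ℤ} (hc : dot3 c n = 1) (hx : dot3 n x = 0)
    (hb : dot3 n b = 0) : cross3 x b = dot3 c (cross3 x b) • n :=
  eq_smul_of_cross3_eq_zero hc (cross3_cross3_eq_zero hx hb)

/-! ### Integers in real intervals -/

/-- A finite set of integers contained in a real interval `[a, a + L]` has at most `L + 1` elements.
[folklore] -/
theorem card_int_le_of_forall_mem_Icc {T : Finset ℤ} {a L : ℝ} (hL : 0 ≤ L)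
    (h : ∀ t ∈ T, a ≤ (t : ℝ) ∧ (t : ℝ) ≤ a + L) : (#T : ℝ) ≤ L + 1 := by
  have hsub : T ⊆ Icc ⌈a⌉ ⌊a + L⌋ := by
    intro t ht
    obtain ⟨h1, h2⟩ := h t ht
    rw [mem_Icc]
    exact ⟨Int.ceil_le.mpr h1, Int.le_floor.mpr h2⟩
  have hcard := card_le_card hsub
  rw [Int.card_Icc] at hcard
  have h1 : ((⌊a + L⌋ + 1 - ⌈a⌉).toNat : ℝ) ≤ L + 1 := by
    rcases le_or_gt 0 (⌊a + L⌋ + 1 - ⌈a⌉) with hnn | hneg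
    · have : (((⌊a + L⌋ + 1 - ⌈a⌉).toNat : ℤ) : ℝ) = ((⌊a + L⌋ + 1 - ⌈a⌉ : ℤ) : ℝ) := by
        rw [Int.toNat_of_nonneg hnn]
      rw [show (((⌊a + L⌋ + 1 - ⌈a⌉).toNat : ℕ) : ℝ) = (((⌊a + L⌋ + 1 - ⌈a⌉).toNat : ℤ) : ℝ) by
        norm_cast, this]
      push_cast
      have e1 : (⌊a + L⌋ : ℝ) ≤ a + L := Int.floor_le _
      have e2 : a ≤ (⌈a⌉ : ℝ) := Int.le_ceil _
      linarith
    · rw [Int.toNat_of_nonpos hneg.le]; simp; linarith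
  calc (#T : ℝ) ≤ ((⌊a + L⌋ + 1 - ⌈a⌉).toNat : ℝ) := by exact_mod_cast hcard
    _ ≤ L + 1 := h1

/-- Integers `t` with `|t − c| ≤ R` number at most `2R + 1`. [folklore] -/
theorem card_int_le_of_forall_abs_sub_le {T : Finset ℤ} {c R : ℝ} (hR : 0 ≤ R)
    (h : ∀ t ∈ T, |(t : ℝ) - c| ≤ R) : (#T : ℝ) ≤ 2 * R + 1 := by
  have := card_int_le_of_forall_mem_Icc (T := T) (a := c - R) (L := 2 * R) (by linarith)
    (fun t ht => by have := abs_le.mp (h t ht); constructor <;> linarith)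
  linarith

/-- A finite set of integer pairs with coordinates in real intervals of lengths `L₁, L₂` has at most
`(L₁ + 1)(L₂ + 1)` elements. [folklore] -/
theorem card_int_prod_le {T : Finset (ℤ × ℤ)} {a₁ L₁ a₂ L₂ : ℝ} (hL₁ : 0 ≤ L₁) (hL₂ : 0 ≤ L₂)
    (h : ∀ t ∈ T, (a₁ ≤ (t.1 : ℝ) ∧ (t.1 : ℝ) ≤ a₁ + L₁) ∧ (a₂ ≤ (t.2 : ℝ) ∧ (t.2 : ℝ) ≤ a₂ + L₂)) :
    (#T : ℝ) ≤ (L₁ + 1) * (L₂ + 1) := by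
  classical
  have hsub : T ⊆ T.image Prod.fst ×ˢ T.image Prod.snd := by
    intro t ht
    rw [mem_product]
    exact ⟨mem_image_of_mem _ ht, mem_image_of_mem _ ht⟩
  have h1 : (#(T.image Prod.fst) : ℝ) ≤ L₁ + 1 :=
    card_int_le_of_forall_mem_Icc hL₁ fun x hx => by
      obtain ⟨t, ht, rfl⟩ := mem_image.mp hx; exact (h t ht).1
  have h2 : (#(T.image Prod.snd) : ℝ) ≤ L₂ + 1 :=
    card_int_le_of_forall_mem_Icc hL₂ fun x hx => by
      obtain ⟨t, ht, rfl⟩ := mem_image.mp hx; exact (h t ht).2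
  calc (#T : ℝ) ≤ #(T.image Prod.fst ×ˢ T.image Prod.snd) := by exact_mod_cast card_le_card hsub
    _ = #(T.image Prod.fst) * #(T.image Prod.snd) := by rw [card_product]; push_cast; ring
    _ ≤ (L₁ + 1) * (L₂ + 1) := mul_le_mul h1 h2 (by positivity) (by linarith)

/-- Integers `m` with `|m q − p| ≤ ρ` (`q ≠ 0` an integer) lie in an interval of length `2ρ/|q|`.
[folklore] -/
theorem mem_Icc_of_abs_mul_sub_le {m q : ℤ} {p ρ : ℝ} (hq : q ≠ 0) (h : |(m : ℝ) * q - p| ≤ ρ) :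
    p / q - ρ / |(q : ℝ)| ≤ (m : ℝ) ∧ (m : ℝ) ≤ p / q - ρ / |(q : ℝ)| + 2 * ρ / |(q : ℝ)| := by
  have hq' : (q : ℝ) ≠ 0 := by exact_mod_cast hq
  have hqa : 0 < |(q : ℝ)| := abs_pos.mpr hq'
  have key : |(m : ℝ) - p / q| ≤ ρ / |(q : ℝ)| := by
    rw [show (m : ℝ) - p / q = ((m : ℝ) * q - p) / q by field_simp, abs_div]
    exact div_le_div_of_nonneg_right h hqa.le
  rw [abs_le] at key
  have e2 : 2 * ρ / |(q : ℝ)| = 2 * (ρ / |(q : ℝ)|) := by ring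
  rw [e2]
  constructor <;> linarith [key.1, key.2]

/-! ### The cylinder count (p. 71) -/

open scoped Classical in
/-- **Lattice points in a cylinder** (p. 71: "the cylindrical region for `β̂₂` … contains
`O(V^{1/3}(DXV^{−2/3})²)` points"): for `γ ∈ ℤ³ ∖ {0}`, `ρ, R ≥ 0` and any centre `c`, the integer
vectors `m` with `|γ ∧ m|_∞ ≤ ρ` and `|m − c|_∞ ≤ R` number at most `(2R + 1)(2ρ/|γ|_∞ + 1)²`
(slice by the coordinate `m_j` where `|γ_j| = |γ|_∞`; the other two coordinates are then confined to
intervals of length `2ρ/|γ|_∞`). [cite: HeathBrownActa2001, §11 p. 71] -/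
theorem card_filter_abs_cross3_le {γ : ℤ × ℤ × ℤ} (hγ : γ ≠ 0) {ρ R : ℝ} (hρ : 0 ≤ ρ) (hR : 0 ≤ R)
    (c : ℝ × ℝ × ℝ) (s : Finset (ℤ × ℤ × ℤ)) :
    (#(s.filter (fun m => (|((cross3 γ m).1 : ℝ)| ≤ ρ ∧ |((cross3 γ m).2.1 : ℝ)| ≤ ρ ∧
        |((cross3 γ m).2.2 : ℝ)| ≤ ρ) ∧ (|(m.1 : ℝ) - c.1| ≤ R ∧ |(m.2.1 : ℝ) - c.2.1| ≤ R ∧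
          |(m.2.2 : ℝ) - c.2.2| ≤ R))) : ℝ) ≤ (2 * R + 1) * (2 * ρ / (supZ γ : ℝ) + 1) ^ 2 := by
  classical
  set G : ℤ := supZ γ with hG
  have hG1 : 1 ≤ G := one_le_supZ hγ
  have hGpos : (0 : ℝ) < G := by exact_mod_cast (show (0 : ℤ) < G by omega)
  set S := s.filter (fun m => (|((cross3 γ m).1 : ℝ)| ≤ ρ ∧ |((cross3 γ m).2.1 : ℝ)| ≤ ρ ∧
        |((cross3 γ m).2.2 : ℝ)| ≤ ρ) ∧ (|(m.1 : ℝ) - c.1| ≤ R ∧ |(m.2.1 : ℝ) - c.2.1| ≤ R ∧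
          |(m.2.2 : ℝ) - c.2.2| ≤ R)) with hS
  have hW : 0 ≤ 2 * ρ / (G : ℝ) := by positivity
  -- we do the three cases by hand via a common lemma on an abstract "good coordinate"
  have main : ∀ (e : ℤ × ℤ × ℤ ≃ ℤ × ℤ × ℤ) (q g₁ g₂ : ℤ) (cj : ℝ), q ≠ 0 → |q| = G →
      (∀ m ∈ S, |((e m).1 : ℝ) - cj| ≤ R) →
      (∀ m ∈ S, |((e m).2.1 : ℝ) * q - ((e m).1 : ℝ) * g₁| ≤ ρ) →
      (∀ m ∈ S, |((e m).2.2 : ℝ) * q - ((e m).1 : ℝ) * g₂| ≤ ρ) →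
      (#S : ℝ) ≤ (2 * R + 1) * (2 * ρ / (G : ℝ) + 1) ^ 2 := by
    intro e q g₁ g₂ cj hq hqG hc h1 h2
    have hqabs : |(q : ℝ)| = G := by rw [← Int.cast_abs, hqG]
    -- image of the first coordinate
    set f : ℤ × ℤ × ℤ → ℤ := fun m => (e m).1 with hf
    have himg : (#(S.image f) : ℝ) ≤ 2 * R + 1 :=
      card_int_le_of_forall_abs_sub_le hR fun t ht => by
        obtain ⟨m, hm, rfl⟩ := mem_image.mp ht; exact hc m hm
    -- fibres
    have hfib : ∀ t ∈ S.image f, (#(S.filter (fun m => f m = t)) : ℝ) ≤ (2 * ρ / (G : ℝ) + 1) ^ 2 := by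
      intro t _
      set F := S.filter (fun m => f m = t) with hF
      -- inject the fibre into `ℤ × ℤ` by the other two coordinates
      have hinj : Set.InjOn (fun m => ((e m).2.1, (e m).2.2)) (F : Set (ℤ × ℤ × ℤ)) := by
        intro m hm m' hm' hmm
        simp only [hF, coe_filter, Set.mem_setOf_eq] at hm hm'
        have hfst : (e m).1 = (e m').1 := by
          have h' : f m = f m' := hm.2.trans hm'.2.symm
          exact h'
        have := Prod.ext_iff.mp hmm
        apply e.injective
        exact Prod.ext hfst (Prod.ext this.1 this.2)
      have hcard : #F = #(F.image (fun m => ((e m).2.1, (e m).2.2))) :=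
        (card_image_of_injOn hinj).symm
      rw [hcard]
      have := card_int_prod_le (T := F.image (fun m => ((e m).2.1, (e m).2.2)))
        (a₁ := (t : ℝ) * g₁ / q - ρ / |(q : ℝ)|) (L₁ := 2 * ρ / |(q : ℝ)|)
        (a₂ := (t : ℝ) * g₂ / q - ρ / |(q : ℝ)|) (L₂ := 2 * ρ / |(q : ℝ)|)
        (by rw [hqabs]; exact hW) (by rw [hqabs]; exact hW) ?_
      · rw [hqabs] at this
        calc (#(F.image (fun m => ((e m).2.1, (e m).2.2))) : ℝ)
            ≤ (2 * ρ / G + 1) * (2 * ρ / G + 1) := this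
          _ = (2 * ρ / (G : ℝ) + 1) ^ 2 := by ring
      · intro p hp
        obtain ⟨m, hm, rfl⟩ := mem_image.mp hp
        rw [hF, mem_filter] at hm
        have hmS := hm.1
        have hmt : ((e m).1 : ℝ) = t := by rw [← hm.2]
        constructor
        · have := mem_Icc_of_abs_mul_sub_le hq (h1 m hmS)
          rw [hmt] at this; simpa [mul_div_assoc] using this
        · have := mem_Icc_of_abs_mul_sub_le hq (h2 m hmS)
          rw [hmt] at this; simpa [mul_div_assoc] using this
    -- `#S = ∑_{t ∈ image} #fibre`
    have hsum : #S = ∑ t ∈ S.image f, #(S.filter (fun m => f m = t)) := card_eq_sum_card_image f S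
    calc (#S : ℝ) = ∑ t ∈ S.image f, (#(S.filter (fun m => f m = t)) : ℝ) := by
          rw [hsum]; push_cast; rfl
      _ ≤ ∑ _t ∈ S.image f, (2 * ρ / (G : ℝ) + 1) ^ 2 := sum_le_sum hfib
      _ = #(S.image f) * (2 * ρ / (G : ℝ) + 1) ^ 2 := by rw [sum_const, nsmul_eq_mul]
      _ ≤ (2 * R + 1) * (2 * ρ / (G : ℝ) + 1) ^ 2 := by gcongr
  -- membership facts
  have hmem : ∀ m ∈ S, (|((cross3 γ m).1 : ℝ)| ≤ ρ ∧ |((cross3 γ m).2.1 : ℝ)| ≤ ρ ∧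
      |((cross3 γ m).2.2 : ℝ)| ≤ ρ) ∧ (|(m.1 : ℝ) - c.1| ≤ R ∧ |(m.2.1 : ℝ) - c.2.1| ≤ R ∧
        |(m.2.2 : ℝ) - c.2.2| ≤ R) := fun m hm => (mem_filter.mp hm).2
  -- the three cases
  rcases exists_abs_eq_supZ γ with hj | hj | hj
  · -- `j = 1`: coordinates `(m₁, m₂, m₃)`, `|m₂γ₁ − m₁γ₂| ≤ ρ`, `|m₃γ₁ − m₁γ₃| ≤ ρ`
    have hq : γ.1 ≠ 0 := by intro h; rw [h, abs_zero] at hj; omega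
    refine main (Equiv.refl _) γ.1 γ.2.1 γ.2.2 c.1 hq hj (fun m hm => (hmem m hm).2.1) ?_ ?_
    · intro m hm
      have h := (hmem m hm).1.2.2  -- third component: `γ₁ m₂ − γ₂ m₁`
      simp only [cross3, Int.cast_sub, Int.cast_mul, Equiv.refl_apply] at h ⊢
      rw [show (m.2.1 : ℝ) * γ.1 - m.1 * γ.2.1 = γ.1 * m.2.1 - γ.2.1 * m.1 by ring]; exact h
    · intro m hm
      have h := (hmem m hm).1.2.1  -- second component: `γ₃ m₁ − γ₁ m₃`
      simp only [cross3, Int.cast_sub, Int.cast_mul, Equiv.refl_apply] at h ⊢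
      rw [show (m.2.2 : ℝ) * γ.1 - m.1 * γ.2.2 = -(γ.2.2 * m.1 - γ.1 * m.2.2) by ring, abs_neg]; exact h
  · -- `j = 2`: use the coordinate permutation `(m₁, m₂, m₃) ↦ (m₂, m₁, m₃)`
    have hq : γ.2.1 ≠ 0 := by intro h; rw [h, abs_zero] at hj; omega
    let e : ℤ × ℤ × ℤ ≃ ℤ × ℤ × ℤ :=
      { toFun := fun m => (m.2.1, m.1, m.2.2), invFun := fun m => (m.2.1, m.1, m.2.2),
        left_inv := fun m => rfl, right_inv := fun m => rfl }
    refine main e γ.2.1 γ.1 γ.2.2 c.2.1 hq hj (fun m hm => (hmem m hm).2.2.1) ?_ ?_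
    · intro m hm
      have h := (hmem m hm).1.2.2  -- `γ₁ m₂ − γ₂ m₁`
      simp only [cross3, Int.cast_sub, Int.cast_mul] at h
      show |(m.1 : ℝ) * γ.2.1 - m.2.1 * γ.1| ≤ ρ
      rw [show (m.1 : ℝ) * γ.2.1 - m.2.1 * γ.1 = -(γ.1 * m.2.1 - γ.2.1 * m.1) by ring, abs_neg]; exact h
    · intro m hm
      have h := (hmem m hm).1.1  -- `γ₂ m₃ − γ₃ m₂`
      simp only [cross3, Int.cast_sub, Int.cast_mul] at h
      show |(m.2.2 : ℝ) * γ.2.1 - m.2.1 * γ.2.2| ≤ ρ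
      rw [show (m.2.2 : ℝ) * γ.2.1 - m.2.1 * γ.2.2 = γ.2.1 * m.2.2 - γ.2.2 * m.2.1 by ring]; exact h
  · -- `j = 3`: `(m₁, m₂, m₃) ↦ (m₃, m₁, m₂)`
    have hq : γ.2.2 ≠ 0 := by intro h; rw [h, abs_zero] at hj; omega
    let e : ℤ × ℤ × ℤ ≃ ℤ × ℤ × ℤ :=
      { toFun := fun m => (m.2.2, m.1, m.2.1), invFun := fun m => (m.2.1, m.2.2, m.1),
        left_inv := fun m => rfl, right_inv := fun m => rfl }
    refine main e γ.2.2 γ.1 γ.2.1 c.2.2 hq hj (fun m hm => (hmem m hm).2.2.2) ?_ ?_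
    · intro m hm
      have h := (hmem m hm).1.2.1  -- `γ₃ m₁ − γ₁ m₃`
      simp only [cross3, Int.cast_sub, Int.cast_mul] at h
      show |(m.1 : ℝ) * γ.2.2 - m.2.2 * γ.1| ≤ ρ
      rw [show (m.1 : ℝ) * γ.2.2 - m.2.2 * γ.1 = γ.2.2 * m.1 - γ.1 * m.2.2 by ring]; exact h
    · intro m hm
      have h := (hmem m hm).1.1  -- `γ₂ m₃ − γ₃ m₂`
      simp only [cross3, Int.cast_sub, Int.cast_mul] at h
      show |(m.2.1 : ℝ) * γ.2.2 - m.2.2 * γ.2.1| ≤ ρ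
      rw [show (m.2.1 : ℝ) * γ.2.2 - m.2.2 * γ.2.1 = -(γ.2.1 * m.2.2 - γ.2.2 * m.2.1) by ring, abs_neg]
      exact h

/-! ### Integer points of a box in a slab (the linear case of Lemma 4.9) -/

open scoped Classical in
/-- **Integer vectors of a box lying in a slab**: for `a ∈ ℝ³` with `|a|_∞ = A > 0`,
`#{n : |n − c|_∞ ≤ R, |a·n − h| ≤ w} ≤ (2R + 1)²(2w/A + 1)` (fix the two coordinates other than the
one where `|a_j| = A`; the remaining coordinate is confined to an interval of length `2w/A`). This is
Lemma 4.9 for a linear form ("`δ ∂F/∂x₁ ≪ R²S₀` … `#ℬ₁(u) ≪ 1`"). [cite: HeathBrownActa2001, Lemma 4.9] -/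
theorem card_filter_abs_dot_sub_le (a : ℝ × ℝ × ℝ) {A : ℝ} (hA : 0 < A)
    (hAa : max |a.1| (max |a.2.1| |a.2.2|) = A) (h : ℝ) {w R : ℝ} (hw : 0 ≤ w) (hR : 0 ≤ R)
    (c : ℝ × ℝ × ℝ) (s : Finset (ℤ × ℤ × ℤ)) :
    (#(s.filter (fun n => (|(n.1 : ℝ) - c.1| ≤ R ∧ |(n.2.1 : ℝ) - c.2.1| ≤ R ∧ |(n.2.2 : ℝ) - c.2.2| ≤ R) ∧
        |a.1 * n.1 + a.2.1 * n.2.1 + a.2.2 * n.2.2 - h| ≤ w)) : ℝ) ≤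
      (2 * R + 1) ^ 2 * (2 * w / A + 1) := by
  classical
  set S := s.filter (fun n => (|(n.1 : ℝ) - c.1| ≤ R ∧ |(n.2.1 : ℝ) - c.2.1| ≤ R ∧
      |(n.2.2 : ℝ) - c.2.2| ≤ R) ∧ |a.1 * n.1 + a.2.1 * n.2.1 + a.2.2 * n.2.2 - h| ≤ w) with hS
  have hmem : ∀ n ∈ S, (|(n.1 : ℝ) - c.1| ≤ R ∧ |(n.2.1 : ℝ) - c.2.1| ≤ R ∧ |(n.2.2 : ℝ) - c.2.2| ≤ R) ∧
      |a.1 * n.1 + a.2.1 * n.2.1 + a.2.2 * n.2.2 - h| ≤ w := fun n hn => (mem_filter.mp hn).2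
  -- abstract slicing: `e` moves the good coordinate to the front
  have main : ∀ (e : ℤ × ℤ × ℤ ≃ ℤ × ℤ × ℤ) (aj a' a'' : ℝ) (c₁ c₂ : ℝ), |aj| = A →
      (∀ n ∈ S, |((e n).2.1 : ℝ) - c₁| ≤ R ∧ |((e n).2.2 : ℝ) - c₂| ≤ R) →
      (∀ n ∈ S, |aj * (e n).1 + a' * (e n).2.1 + a'' * (e n).2.2 - h| ≤ w) →
      (#S : ℝ) ≤ (2 * R + 1) ^ 2 * (2 * w / A + 1) := by
    intro e aj a' a'' c₁ c₂ haj hc hlin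
    have haj0 : aj ≠ 0 := by intro h0; rw [h0, abs_zero] at haj; linarith
    set f : ℤ × ℤ × ℤ → ℤ × ℤ := fun n => ((e n).2.1, (e n).2.2) with hf
    have himg : (#(S.image f) : ℝ) ≤ (2 * R + 1) * (2 * R + 1) := by
      refine card_int_prod_le (a₁ := c₁ - R) (L₁ := 2 * R) (a₂ := c₂ - R) (L₂ := 2 * R)
        (by linarith) (by linarith) fun p hp => ?_
      obtain ⟨n, hn, rfl⟩ := mem_image.mp hp
      obtain ⟨h1, h2⟩ := hc n hn
      rw [abs_le] at h1 h2
      simp only [hf]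
      exact ⟨⟨by linarith [h1.1], by linarith [h1.2]⟩, ⟨by linarith [h2.1], by linarith [h2.2]⟩⟩
    have hfib : ∀ p ∈ S.image f, (#(S.filter (fun n => f n = p)) : ℝ) ≤ 2 * w / A + 1 := by
      intro p _
      set F := S.filter (fun n => f n = p) with hF
      have hinj : Set.InjOn (fun n => (e n).1) (F : Set (ℤ × ℤ × ℤ)) := by
        intro n hn n' hn' hnn
        simp only [hF, coe_filter, Set.mem_setOf_eq] at hn hn'
        have h2 : f n = f n' := hn.2.trans hn'.2.symm
        simp only [hf, Prod.mk.injEq] at h2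
        apply e.injective
        exact Prod.ext hnn (Prod.ext h2.1 h2.2)
      rw [← card_image_of_injOn hinj]
      refine card_int_le_of_forall_mem_Icc (a := (h - a' * p.1 - a'' * p.2) / aj - w / |aj|)
        (L := 2 * w / A) (by positivity) fun t ht => ?_
      obtain ⟨n, hn, rfl⟩ := mem_image.mp ht
      rw [hF, mem_filter] at hn
      have hp : f n = p := hn.2
      simp only [hf] at hp
      have hl := hlin n hn.1
      rw [← hp]
      have key : |((e n).1 : ℝ) - (h - a' * ((e n).2.1 : ℤ) - a'' * ((e n).2.2 : ℤ)) / aj| ≤ w / |aj| := by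
        rw [show ((e n).1 : ℝ) - (h - a' * ((e n).2.1 : ℤ) - a'' * ((e n).2.2 : ℤ)) / aj =
          (aj * (e n).1 + a' * (e n).2.1 + a'' * (e n).2.2 - h) / aj by field_simp; ring, abs_div]
        exact div_le_div_of_nonneg_right hl (abs_nonneg _)
      rw [abs_le] at key
      rw [haj] at key ⊢
      have e2 : 2 * w / A = 2 * (w / A) := by ring
      rw [e2]
      constructor <;> linarith [key.1, key.2]
    have hsum : #S = ∑ p ∈ S.image f, #(S.filter (fun n => f n = p)) := card_eq_sum_card_image f S
    calc (#S : ℝ) = ∑ p ∈ S.image f, (#(S.filter (fun n => f n = p)) : ℝ) := by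
          rw [hsum]; push_cast; rfl
      _ ≤ ∑ _p ∈ S.image f, (2 * w / A + 1) := sum_le_sum hfib
      _ = #(S.image f) * (2 * w / A + 1) := by rw [sum_const, nsmul_eq_mul]
      _ ≤ (2 * R + 1) * (2 * R + 1) * (2 * w / A + 1) := by gcongr
      _ = (2 * R + 1) ^ 2 * (2 * w / A + 1) := by ring
  -- the three cases
  rcases le_total (max |a.2.1| |a.2.2|) |a.1| with h1 | h1
  · have haj : |a.1| = A := by rw [← hAa, max_eq_left h1]
    exact main (Equiv.refl _) a.1 a.2.1 a.2.2 c.2.1 c.2.2 haj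
      (fun n hn => ⟨(hmem n hn).1.2.1, (hmem n hn).1.2.2⟩) (fun n hn => (hmem n hn).2)
  · rw [max_eq_right h1] at hAa
    rcases le_total |a.2.2| |a.2.1| with h2 | h2
    · have haj : |a.2.1| = A := by rw [← hAa, max_eq_left h2]
      let e : ℤ × ℤ × ℤ ≃ ℤ × ℤ × ℤ :=
        { toFun := fun m => (m.2.1, m.1, m.2.2), invFun := fun m => (m.2.1, m.1, m.2.2),
          left_inv := fun m => rfl, right_inv := fun m => rfl }
      refine main e a.2.1 a.1 a.2.2 c.1 c.2.2 haj
        (fun n hn => ⟨(hmem n hn).1.1, (hmem n hn).1.2.2⟩) (fun n hn => ?_)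
      have := (hmem n hn).2
      show |a.2.1 * (n.2.1 : ℤ) + a.1 * (n.1 : ℤ) + a.2.2 * (n.2.2 : ℤ) - h| ≤ w
      rwa [show a.2.1 * ((n.2.1 : ℤ) : ℝ) + a.1 * ((n.1 : ℤ) : ℝ) + a.2.2 * ((n.2.2 : ℤ) : ℝ) =
        a.1 * n.1 + a.2.1 * n.2.1 + a.2.2 * n.2.2 by ring]
    · have haj : |a.2.2| = A := by rw [← hAa, max_eq_right h2]
      let e : ℤ × ℤ × ℤ ≃ ℤ × ℤ × ℤ :=
        { toFun := fun m => (m.2.2, m.1, m.2.1), invFun := fun m => (m.2.1, m.2.2, m.1),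
          left_inv := fun m => rfl, right_inv := fun m => rfl }
      refine main e a.2.2 a.1 a.2.1 c.1 c.2.1 haj
        (fun n hn => ⟨(hmem n hn).1.1, (hmem n hn).1.2.1⟩) (fun n hn => ?_)
      have := (hmem n hn).2
      show |a.2.2 * (n.2.2 : ℤ) + a.1 * (n.1 : ℤ) + a.2.1 * (n.2.1 : ℤ) - h| ≤ w
      rwa [show a.2.2 * ((n.2.2 : ℤ) : ℝ) + a.1 * ((n.1 : ℤ) : ℝ) + a.2.1 * ((n.2.1 : ℤ) : ℝ) =
        a.1 * n.1 + a.2.1 * n.2.1 + a.2.2 * n.2.2 by ring]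

/-! ### Points of a plane lattice in a box (Lemma 4.8 / p. 77) -/

open scoped Classical in
/-- **Points of the lattice `n^⊥ ∩ ℤ³` in a box, fibred along a primitive `b ⊥ n`** (`n` primitive):
`#{x : n·x = 0, |x − c|_∞ ≤ U} ≤ (8U|b|_∞/|n|_∞ + 1)(2U/|b|_∞ + 1)`. The fibres are the lines
`x₀ + ℤ b` (indexed by the integer `μ` with `x ∧ b = μ n`, confined to an interval of length
`8U|b|_∞/|n|_∞`), each meeting the box in at most `2U/|b|_∞ + 1` points. This replaces Lemma 4.8 and
the count "`≪ (V^{2/3}/(|z₁||z₂|))(1 + V^{1/3}/|z₂|)`" of p. 77. [cite: HeathBrownActa2001, Lemma 4.8] -/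
theorem card_filter_dot_eq_zero_le {n b : ℤ × ℤ × ℤ} (hn : IsPrimitiveVec n) (hb : IsPrimitiveVec b)
    (hnb : dot3 n b = 0) (c : ℝ × ℝ × ℝ) {U : ℝ} (hU : 0 ≤ U) (s : Finset (ℤ × ℤ × ℤ)) :
    (#(s.filter (fun x => dot3 n x = 0 ∧ (|(x.1 : ℝ) - c.1| ≤ U ∧ |(x.2.1 : ℝ) - c.2.1| ≤ U ∧
        |(x.2.2 : ℝ) - c.2.2| ≤ U))) : ℝ) ≤
      (8 * U * (supZ b : ℝ) / (supZ n : ℝ) + 1) * (2 * U / (supZ b : ℝ) + 1) := by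
  classical
  set S := s.filter (fun x => dot3 n x = 0 ∧ (|(x.1 : ℝ) - c.1| ≤ U ∧ |(x.2.1 : ℝ) - c.2.1| ≤ U ∧
        |(x.2.2 : ℝ) - c.2.2| ≤ U)) with hS
  have hmem : ∀ x ∈ S, dot3 n x = 0 ∧ (|(x.1 : ℝ) - c.1| ≤ U ∧ |(x.2.1 : ℝ) - c.2.1| ≤ U ∧
      |(x.2.2 : ℝ) - c.2.2| ≤ U) := fun x hx => (mem_filter.mp hx).2
  set B : ℤ := supZ b with hB
  set N : ℤ := supZ n with hN
  have hB1 : 1 ≤ B := one_le_supZ hb.ne_zero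
  have hN1 : 1 ≤ N := one_le_supZ hn.ne_zero
  have hBpos : (0 : ℝ) < B := by exact_mod_cast (show (0 : ℤ) < B by omega)
  have hNpos : (0 : ℝ) < N := by exact_mod_cast (show (0 : ℤ) < N by omega)
  have hRHS : 0 ≤ (8 * U * (B : ℝ) / (N : ℝ) + 1) * (2 * U / (B : ℝ) + 1) := by positivity
  rcases S.eq_empty_or_nonempty with hempty | ⟨x₀, hx₀⟩
  · rw [hempty, card_empty]; simpa using hRHS
  -- the integer `μ(x)` with `x ∧ b = μ(x) n`
  obtain ⟨cn, hcn⟩ := exists_dot_eq_one hn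
  have hcn' : dot3 cn n = 1 := by simpa [dot3] using hcn
  set μ : ℤ × ℤ × ℤ → ℤ := fun x => dot3 cn (cross3 x b) with hμ
  have hμn : ∀ x ∈ S, cross3 x b = μ x • n := fun x hx =>
    cross3_eq_smul_of_dot_eq_zero hcn' (hmem x hx).1 hnb
  -- range of `μ`
  set W : ℝ := 4 * U * (B : ℝ) / (N : ℝ) with hW
  have hW0 : 0 ≤ W := by positivity
  have hμrange : ∀ x ∈ S, |((μ x : ℤ) : ℝ) - (μ x₀ : ℝ)| ≤ W := by
    intro x hx
    have hdiff : cross3 (x - x₀) b = (μ x - μ x₀) • n := by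
      rw [cross3_sub_left, hμn x hx, hμn x₀ hx₀, sub_smul]
    have hsup : supZ (cross3 (x - x₀) b) ≤ 2 * supZ (x - x₀) * supZ b := supZ_cross3_le _ _
    rw [hdiff, supZ_smul] at hsup
    -- `supZ (x - x₀) ≤ 2U`
    have hx1 := (hmem x hx).2; have hx2 := (hmem x₀ hx₀).2
    have hdx : (supZ (x - x₀) : ℝ) ≤ 2 * U := by
      have key : ∀ (p q : ℤ) (cc : ℝ), |(p : ℝ) - cc| ≤ U → |(q : ℝ) - cc| ≤ U → (|p - q| : ℝ) ≤ 2 * U := by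
        intro p q cc hp hq
        rw [abs_le] at hp hq
        rw [← Int.cast_sub, ← Int.cast_abs]
        have : |((p - q : ℤ) : ℝ)| ≤ 2 * U := by push_cast; rw [abs_le]; constructor <;> linarith
        exact_mod_cast this
      have e1 := key x.1 x₀.1 c.1 hx1.1 hx2.1
      have e2 := key x.2.1 x₀.2.1 c.2.1 hx1.2.1 hx2.2.1
      have e3 := key x.2.2 x₀.2.2 c.2.2 hx1.2.2 hx2.2.2
      simp only [supZ, Prod.fst_sub, Prod.snd_sub]
      push_cast
      exact max_le e1 (max_le e2 e3)
    have hcast : |((μ x : ℤ) : ℝ) - ((μ x₀ : ℤ) : ℝ)| * (N : ℝ) ≤ 2 * (supZ (x - x₀) : ℝ) * B := by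
      have := hsup; rw [← hN, ← hB] at this
      rw [← Int.cast_sub, ← Int.cast_abs]; exact_mod_cast this
    rw [hW, le_div_iff₀ hNpos]
    calc |((μ x : ℤ) : ℝ) - ((μ x₀ : ℤ) : ℝ)| * (N : ℝ) ≤ 2 * (supZ (x - x₀) : ℝ) * B := hcast
      _ ≤ 2 * (2 * U) * B := by gcongr
      _ = 4 * U * B := by ring
  -- abstract counting along a good coordinate `π` of `b`
  have main : ∀ (π : ℤ × ℤ × ℤ → ℤ) (cj : ℝ), (∀ x y : ℤ × ℤ × ℤ, π (x - y) = π x - π y) →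
      (∀ (t : ℤ) (v : ℤ × ℤ × ℤ), π (t • v) = t * π v) → |π b| = B →
      (∀ x ∈ S, |(π x : ℝ) - cj| ≤ U) →
      (#S : ℝ) ≤ (8 * U * (B : ℝ) / (N : ℝ) + 1) * (2 * U / (B : ℝ) + 1) := by
    intro π cj hπsub hπsmul hπb hπc
    set k : ℤ × ℤ × ℤ → ℤ := fun x => ⌊((π x : ℝ) - (cj - U)) / (B : ℝ)⌋ with hk
    -- injectivity of `x ↦ (μ x, k x)` on `S`
    have hinj : Set.InjOn (fun x => (μ x, k x)) (S : Set (ℤ × ℤ × ℤ)) := by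
      intro x hx x' hx' hxx
      simp only [Prod.mk.injEq] at hxx
      obtain ⟨hμeq, hkeq⟩ := hxx
      have hxS : x ∈ S := hx
      have hx'S : x' ∈ S := hx'
      have hc0 : cross3 b (x - x') = 0 := by
        have h1 : cross3 (x - x') b = 0 := by
          rw [cross3_sub_left, hμn x hxS, hμn x' hx'S, hμeq, sub_self]
        rw [cross3_swap, h1, neg_zero]
      obtain ⟨t, htv⟩ := exists_eq_smul_of_cross3_eq_zero hb hc0
      -- `π x - π x' = t * π b = ± t B`
      have hπd : π x - π x' = t * π b := by rw [← hπsub, htv, hπsmul]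
      have hkd : k x = k x' + t * (π b / B) := by
        have hunit : π b / B = 1 ∨ π b / B = -1 := by
          rcases abs_eq (by omega : (0 : ℤ) ≤ B) |>.mp hπb with h | h
          · left; rw [h]; exact Int.ediv_self (by omega)
          · right; rw [h, Int.neg_ediv_of_dvd (dvd_refl _), Int.ediv_self (by omega)]
        have hratio : ((π b : ℤ) : ℝ) / (B : ℝ) = ((π b / B : ℤ) : ℝ) := by
          rcases hunit with h | h
          · rw [h]; have : π b = B := by
              rcases abs_eq (by omega : (0 : ℤ) ≤ B) |>.mp hπb with h' | h'
              · exact h'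
              · rw [h'] at h; rw [Int.neg_ediv_of_dvd (dvd_refl _), Int.ediv_self (by omega)] at h; omega
            rw [this]; push_cast; field_simp
          · rw [h]; have : π b = -B := by
              rcases abs_eq (by omega : (0 : ℤ) ≤ B) |>.mp hπb with h' | h'
              · rw [h'] at h; rw [Int.ediv_self (by omega)] at h; omega
              · exact h'
            rw [this]; push_cast; field_simp
        simp only [hk]
        have : ((π x : ℝ) - (cj - U)) / (B : ℝ) = ((π x' : ℝ) - (cj - U)) / (B : ℝ) + ((t * (π b / B) : ℤ) : ℝ) := by
          have e1 : (π x : ℝ) = π x' + t * π b := by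
            have := hπd; rw [sub_eq_iff_eq_add'] at this; rw [this]; push_cast; ring
          rw [e1]
          push_cast
          rw [← hratio]
          field_simp
          ring
        rw [this, Int.floor_add_intCast]
      rw [hkeq] at hkd
      have ht0 : t * (π b / B) = 0 := by linarith
      have hunit' : π b / B ≠ 0 := by
        rcases abs_eq (by omega : (0 : ℤ) ≤ B) |>.mp hπb with h | h
        · rw [h, Int.ediv_self (by omega)]; norm_num
        · rw [h, Int.neg_ediv_of_dvd (dvd_refl _), Int.ediv_self (by omega)]; norm_num
      have ht : t = 0 := (mul_eq_zero.mp ht0).resolve_right hunit'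
      rw [ht, zero_smul, sub_eq_zero] at htv
      exact htv
    rw [← card_image_of_injOn hinj, show (8 * U * (B : ℝ) / (N : ℝ) + 1) = 2 * W + 1 by rw [hW]; ring]
    refine card_int_prod_le (a₁ := (μ x₀ : ℝ) - W) (L₁ := 2 * W) (a₂ := 0) (L₂ := 2 * U / B)
      (by positivity) (by positivity) fun p hp => ?_
    obtain ⟨x, hx, rfl⟩ := mem_image.mp hp
    have hr := hμrange x hx
    rw [abs_le] at hr
    refine ⟨⟨by linarith [hr.1], by linarith [hr.2]⟩, ?_⟩
    -- `0 ≤ k x ≤ 2U/B`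
    have hπx := hπc x hx
    rw [abs_le] at hπx
    have hnum0 : 0 ≤ ((π x : ℝ) - (cj - U)) / (B : ℝ) := div_nonneg (by linarith) hBpos.le
    have hnum1 : ((π x : ℝ) - (cj - U)) / (B : ℝ) ≤ 2 * U / B :=
      div_le_div_of_nonneg_right (by linarith) hBpos.le
    simp only [hk]
    constructor
    · exact_mod_cast Int.floor_nonneg.mpr hnum0
    · rw [zero_add]; exact (Int.floor_le _).trans hnum1
  -- the three cases for the good coordinate of `b`
  rcases exists_abs_eq_supZ b with hj | hj | hj
  · exact main Prod.fst c.1 (fun x y => rfl) (fun t v => rfl) hj fun x hx => (hmem x hx).2.1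
  · exact main (fun v => v.2.1) c.2.1 (fun x y => rfl) (fun t v => rfl) hj fun x hx => (hmem x hx).2.2.1
  · exact main (fun v => v.2.2) c.2.2 (fun x y => rfl) (fun t v => rfl) hj fun x hx => (hmem x hx).2.2.2

/-! ### The gap lemma and points near a level set of a one-variable cubic (Lemma 4.9) -/

/-- **The gap lemma**: a finite set of integers contained in an interval of length `ℓ`, any two of
whose elements are at distance `≤ A` or `≥ B` (`B > 0`), has at most `(ℓ/B + 1)(A + 1)` elements
(peel off the `≤ A + 1` elements within `A` of the minimum; the rest start at least `B` further on).
This is the counting step of Lemma 4.9 ("either `δ ≪ S₀` or `|δ| ≫ R` … `#ℬ₁(u) ≪ 1`").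
[cite: HeathBrownActa2001, Lemma 4.9] -/
theorem card_le_of_gap {A B : ℝ} (hA : 0 ≤ A) :
    ∀ (k : ℕ) (S : Finset ℤ) (L ℓ : ℝ), ℓ < (k + 1) * B →
      (∀ s ∈ S, L ≤ (s : ℝ) ∧ (s : ℝ) ≤ L + ℓ) →
      (∀ s ∈ S, ∀ t ∈ S, |(s : ℝ) - t| ≤ A ∨ B ≤ |(s : ℝ) - t|) →
      (#S : ℝ) ≤ (k + 1) * (A + 1) := by
  intro k
  induction k with
  | zero =>
    intro S L ℓ hℓ hS hgap
    simp only [CharP.cast_eq_zero, zero_add, one_mul] at hℓ ⊢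
    rcases S.eq_empty_or_nonempty with hempty | hne
    · rw [hempty, card_empty]; simp; linarith
    · set m := S.min' hne with hm
      have hmS : m ∈ S := S.min'_mem hne
      refine card_int_le_of_forall_mem_Icc (a := m) hA fun s hs => ?_
      have hms : m ≤ s := S.min'_le s hs
      refine ⟨by exact_mod_cast hms, ?_⟩
      rcases hgap s hs m hmS with h | h
      · rw [abs_le] at h; linarith [h.2]
      · exfalso
        have h1 := (hS s hs).2; have h2 := (hS m hmS).1
        have : |(s : ℝ) - m| ≤ ℓ := by
          rw [abs_le]; constructor <;> [linarith [show (m : ℝ) ≤ s by exact_mod_cast hms]; linarith]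
        linarith
  | succ k ih =>
    intro S L ℓ hℓ hS hgap
    classical
    rcases S.eq_empty_or_nonempty with hempty | hne
    · rw [hempty, card_empty]; push_cast; nlinarith
    set m := S.min' hne with hm
    have hmS : m ∈ S := S.min'_mem hne
    set S₁ := S.filter (fun s : ℤ => (s : ℝ) ≤ m + A) with hS₁
    set S₂ := S.filter (fun s : ℤ => ¬ ((s : ℝ) ≤ m + A)) with hS₂
    have hsplit : #S = #S₁ + #S₂ := by
      rw [hS₁, hS₂]; exact (card_filter_add_card_filter_not (fun s : ℤ => (s : ℝ) ≤ m + A)).symm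
    have h1 : (#S₁ : ℝ) ≤ A + 1 := by
      refine card_int_le_of_forall_mem_Icc (a := m) hA fun s hs => ?_
      rw [hS₁, mem_filter] at hs
      exact ⟨by exact_mod_cast S.min'_le s hs.1, hs.2⟩
    -- `S₂ ⊆ [L + B, L + ℓ]`
    have h2 : (#S₂ : ℝ) ≤ (k + 1) * (A + 1) := by
      rcases lt_or_ge ℓ B with hℓB | hℓB
      · have : S₂ = ∅ := by
          rw [hS₂, filter_eq_empty_iff]
          intro s hs hnot
          push Not at hnot
          have hms : (m : ℝ) ≤ s := by exact_mod_cast S.min'_le s hs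
          rcases hgap s hs m hmS with h | h
          · rw [abs_le] at h; linarith [h.2]
          · have e1 := (hS s hs).2; have e2 := (hS m hmS).1
            rw [abs_of_nonneg (by linarith)] at h
            linarith
        rw [this, card_empty]; push_cast; positivity
      · refine ih S₂ (L + B) (ℓ - B) (by push_cast at hℓ ⊢; linarith) (fun s hs => ?_) (fun s hs t ht => ?_)
        · rw [hS₂, mem_filter] at hs
          obtain ⟨hsS, hnot⟩ := hs
          push Not at hnot
          have hms : (m : ℝ) ≤ s := by exact_mod_cast S.min'_le s hsS
          refine ⟨?_, by linarith [(hS s hsS).2]⟩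
          rcases hgap s hsS m hmS with h | h
          · rw [abs_le] at h; linarith [h.2]
          · rw [abs_of_nonneg (by linarith)] at h
            linarith [(hS m hmS).1]
        · rw [hS₂, mem_filter] at hs ht
          exact hgap s hs.1 t ht.1
    calc (#S : ℝ) = #S₁ + #S₂ := by rw [hsplit]; push_cast; ring
      _ ≤ (A + 1) + (k + 1) * (A + 1) := add_le_add h1 h2
      _ = ((k + 1 : ℕ) + 1 : ℝ) * (A + 1) := by push_cast; ring

/-- The gap lemma in closed form: `#S ≤ (ℓ/B + 1)(A + 1)`. [cite: HeathBrownActa2001, Lemma 4.9] -/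
theorem card_le_of_gap' {A B ℓ L : ℝ} (hA : 0 ≤ A) (hB : 0 < B) (hℓ : 0 ≤ ℓ) (S : Finset ℤ)
    (hS : ∀ s ∈ S, L ≤ (s : ℝ) ∧ (s : ℝ) ≤ L + ℓ)
    (hgap : ∀ s ∈ S, ∀ t ∈ S, |(s : ℝ) - t| ≤ A ∨ B ≤ |(s : ℝ) - t|) :
    (#S : ℝ) ≤ (ℓ / B + 1) * (A + 1) := by
  set k : ℕ := ⌊ℓ / B⌋₊ with hk
  have hk1 : ℓ < (k + 1) * B := by
    have := Nat.lt_floor_add_one (ℓ / B)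
    rw [← hk] at this
    rwa [div_lt_iff₀ hB] at this
  have hk2 : (k : ℝ) ≤ ℓ / B := Nat.floor_le (by positivity)
  calc (#S : ℝ) ≤ (k + 1) * (A + 1) := card_le_of_gap hA k S L ℓ hk1 hS hgap
    _ ≤ (ℓ / B + 1) * (A + 1) := by gcongr

/-- **Integers near a level set of a cubic `αt³ + βt`** (the one-variable core of Lemma 4.9): if
every `t ∈ S` has `|t| ≤ R`, `|αt³ + βt − h| ≤ w` and `|3αt² + β| ≥ g > 0` (the derivative is large),
then `#S ≤ (12αR²/g + 1)(4w/g + 1)`. Indeed for `s, t ∈ S`, `δ = s − t`: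
`α s³ + βs − (αt³ + βt) = δ(3αt² + β) + αδ²(s + 2t)`, so `|δ| g ≤ 2w + 3αR δ²`, whence
`|δ| ≤ 4w/g` or `|δ| ≥ g/(6αR)` ("either `δ ≪ S₀` or `|δ| ≫ R`", p. 26), and the gap lemma applies.
[cite: HeathBrownActa2001, Lemma 4.9] -/
theorem card_le_of_cubic_near_level {α β h w R g : ℝ} (hα : 0 < α) (hR : 0 < R) (hg : 0 < g)
    (hw : 0 ≤ w) (S : Finset ℤ)
    (hS : ∀ t ∈ S, |(t : ℝ)| ≤ R ∧ |α * t ^ 3 + β * t - h| ≤ w ∧ g ≤ |3 * α * t ^ 2 + β|) :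
    (#S : ℝ) ≤ (12 * α * R ^ 2 / g + 1) * (4 * w / g + 1) := by
  have hB : 0 < g / (6 * α * R) := by positivity
  have h := card_le_of_gap' (A := 4 * w / g) (B := g / (6 * α * R)) (ℓ := 2 * R) (L := -R)
    (by positivity) hB (by positivity) S (fun t ht => ?_) (fun s hs t ht => ?_)
  · calc (#S : ℝ) ≤ (2 * R / (g / (6 * α * R)) + 1) * (4 * w / g + 1) := h
      _ = (12 * α * R ^ 2 / g + 1) * (4 * w / g + 1) := by
          congr 1; field_simp; ring
  · have := abs_le.mp (hS t ht).1
    constructor <;> linarith [this.1, this.2]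
  · obtain ⟨hsR, hsw, -⟩ := hS s hs
    obtain ⟨htR, htw, htg⟩ := hS t ht
    set δ : ℝ := (s : ℝ) - t with hδ
    by_cases hcase : g / (6 * α * R) ≤ |δ|
    · exact Or.inr hcase
    · left
      push Not at hcase
      -- the Taylor identity
      have hid : (α * s ^ 3 + β * s - h) - (α * t ^ 3 + β * t - h) =
          δ * (3 * α * t ^ 2 + β) + α * δ ^ 2 * (s + 2 * t) := by rw [hδ]; ring
      have hdiff : |δ * (3 * α * t ^ 2 + β) + α * δ ^ 2 * (s + 2 * t)| ≤ 2 * w := by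
        rw [← hid]
        calc |(α * s ^ 3 + β * s - h) - (α * t ^ 3 + β * t - h)|
            ≤ |α * s ^ 3 + β * s - h| + |α * t ^ 3 + β * t - h| := abs_sub _ _
          _ ≤ w + w := add_le_add hsw htw
          _ = 2 * w := by ring
      have hst : |(s : ℝ) + 2 * t| ≤ 3 * R := by
        calc |(s : ℝ) + 2 * t| ≤ |(s : ℝ)| + |2 * (t : ℝ)| := abs_add_le _ _
          _ = |(s : ℝ)| + 2 * |(t : ℝ)| := by rw [abs_mul]; norm_num
          _ ≤ R + 2 * R := by linarith
          _ = 3 * R := by ring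
      -- `|δ| g ≤ 2w + 3αR δ²`
      have hmain : |δ| * g ≤ 2 * w + 3 * α * R * δ ^ 2 := by
        have e1 : |δ| * g ≤ |δ * (3 * α * t ^ 2 + β)| := by
          rw [abs_mul]; exact mul_le_mul_of_nonneg_left htg (abs_nonneg _)
        have e2 : |δ * (3 * α * t ^ 2 + β)| ≤ 2 * w + |α * δ ^ 2 * (s + 2 * t)| := by
          have := abs_sub_abs_le_abs_sub (δ * (3 * α * t ^ 2 + β)) (-(α * δ ^ 2 * (s + 2 * t)))
          rw [sub_neg_eq_add, abs_neg] at this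
          linarith
        have e3 : |α * δ ^ 2 * (s + 2 * t)| ≤ 3 * α * R * δ ^ 2 := by
          rw [abs_mul, abs_mul, abs_of_pos hα, abs_of_nonneg (sq_nonneg δ)]
          calc α * δ ^ 2 * |(s : ℝ) + 2 * t| ≤ α * δ ^ 2 * (3 * R) := by gcongr
            _ = 3 * α * R * δ ^ 2 := by ring
        linarith
      -- since `|δ| < g/(6αR)`: `3αRδ² ≤ |δ| g / 2`
      have hsmall : 3 * α * R * δ ^ 2 ≤ |δ| * g / 2 := by
        have hd0 := abs_nonneg δ
        have : 3 * α * R * |δ| ≤ g / 2 := by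
          have := mul_le_mul_of_nonneg_left hcase.le (by positivity : (0 : ℝ) ≤ 3 * α * R)
          calc 3 * α * R * |δ| ≤ 3 * α * R * (g / (6 * α * R)) := this
            _ = g / 2 := by field_simp; ring
        calc 3 * α * R * δ ^ 2 = (3 * α * R * |δ|) * |δ| := by rw [← sq_abs]; ring
          _ ≤ (g / 2) * |δ| := mul_le_mul_of_nonneg_right this hd0
          _ = |δ| * g / 2 := by ring
      have : |δ| * g ≤ 4 * w := by linarith
      rw [le_div_iff₀ hg]; linarith

end Literature.NumberTheory.Sieve.CubicSieve

end
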